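import Literature.Topology.FourManifolds.IntersectionNumbers
import Mathlib.LinearAlgebra.Matrix.Reindex
import HarnessLib

/-!
# Intersection numbers under reparametrisation of a source manifold

Topic `Literature/Topology/FourManifolds` (proved API for `IntersectionNumbers.lean`; fact seat
`provefact-Literature.Topology.FourManifolds.corkDecomposition`).  Milnor, *Lectures on the
h-cobordism theorem* (1965), §6, Remark 2 (PDF p. 36): the intersection number of oriented
submanifolds depends on the orientations through a sign; in the language of maps
(`Literature.Topology.FourManifolds.intersectionNumber`): precomposing `s : A → X` with a reparametrisation
`ρ : A' → A` (a bijection with invertible differential, e.g. a diffeomorphism) leaves `s · p`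
unchanged if `ρ` preserves the orientations and reverses its sign if `ρ` reverses them —
which is how a family of embedded spheres with `Sᵢ · Pᵢ = ±1` is normalised to `Sᵢ · Pᵢ = +1`
(Milnor 1965, Thm. 7.6: *"the left-hand disks for `ξ'`, when suitably oriented, determine the
given basis"*).  Everything here is proved:

* `Literature.Topology.FourManifolds.det_crossingMatrix_comp_left` — `det [u ∘ r | w] = det [u | w] · det r` (and `_right`);
* `Literature.Topology.FourManifolds.det_crossingMatrixAt_comp_left` — the chain rule read on crossing matrices;
* `Literature.Topology.FourManifolds.localIntersectionSign_comp_left_of_isOrientationPreserving` /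
  `…_of_isOrientationReversing` — local signs under reparametrisation of the first map;
* `Literature.Topology.FourManifolds.intersectionNumber_comp_left_of_isOrientationPreserving` /
  `…_of_isOrientationReversing` — `(s ∘ ρ) · p = ± s · p`;
* `Literature.Topology.FourManifolds.mapsTransverse_comp_left_iff` — transversality is invariant.

## References

* J. Milnor, *Lectures on the h-cobordism theorem*, Princeton (1965), §6 Remark 2 (PDF p. 36),
  Thm. 7.6 (PDF p. 50). [MilnorHCobordism1965]
* M. W. Hirsch, *Differential Topology*, GTM 33 (1976), §4.4. [HirschDT1976]
-/

open scoped Manifold ContDiff Topology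
open Set Module Function

noncomputable section

namespace Literature.Topology.FourManifolds

/-! ### Linear algebra: composing one block with an endomorphism -/

section LinearAlgebra

variable {a b n : ℕ}

/-- Composing the first map with an endomorphism `r` of `ℝᵃ` multiplies the crossing matrix on
the right by the block matrix of `r ⊕ id`. [folklore] -/
theorem crossingMatrix_comp_left (h : a + b = n) (u : EuclideanSpace ℝ (Fin a) →ₗ[ℝ] EuclideanSpace ℝ (Fin n)) (r : EuclideanSpace ℝ (Fin a) →ₗ[ℝ] EuclideanSpace ℝ (Fin a))
    (w : EuclideanSpace ℝ (Fin b) →ₗ[ℝ] EuclideanSpace ℝ (Fin n)) :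
    crossingMatrix h (u ∘ₗ r) w = crossingMatrix h u w *
      Matrix.reindex (finSumFinEquiv.trans (finCongr h)) (finSumFinEquiv.trans (finCongr h))
        (LinearMap.toMatrix ((euclideanStdBasis a).prod (euclideanStdBasis b))
          ((euclideanStdBasis a).prod (euclideanStdBasis b)) (r.prodMap LinearMap.id)) := by
  have hc : (u ∘ₗ r).coprod w = (u.coprod w) ∘ₗ (r.prodMap LinearMap.id) := by
    ext v <;> simp
  unfold crossingMatrix
  rw [hc, LinearMap.toMatrix_comp ((euclideanStdBasis a).prod (euclideanStdBasis b))
    ((euclideanStdBasis a).prod (euclideanStdBasis b)) (euclideanStdBasis n)]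
  simp only [Matrix.reindex_apply, Equiv.refl_symm, Equiv.coe_refl]
  rw [← Matrix.submatrix_mul_equiv _ _ _ (finSumFinEquiv.trans (finCongr h)).symm]

/-- Composing the second map with an endomorphism `r` of `ℝᵇ` multiplies the crossing matrix
on the right by the block matrix of `id ⊕ r`. [folklore] -/
theorem crossingMatrix_comp_right (h : a + b = n) (u : EuclideanSpace ℝ (Fin a) →ₗ[ℝ] EuclideanSpace ℝ (Fin n)) (w : EuclideanSpace ℝ (Fin b) →ₗ[ℝ] EuclideanSpace ℝ (Fin n))
    (r : EuclideanSpace ℝ (Fin b) →ₗ[ℝ] EuclideanSpace ℝ (Fin b)) :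
    crossingMatrix h u (w ∘ₗ r) = crossingMatrix h u w *
      Matrix.reindex (finSumFinEquiv.trans (finCongr h)) (finSumFinEquiv.trans (finCongr h))
        (LinearMap.toMatrix ((euclideanStdBasis a).prod (euclideanStdBasis b))
          ((euclideanStdBasis a).prod (euclideanStdBasis b)) (LinearMap.id.prodMap r)) := by
  have hc : u.coprod (w ∘ₗ r) = (u.coprod w) ∘ₗ (LinearMap.id.prodMap r) := by
    ext v <;> simp
  unfold crossingMatrix
  rw [hc, LinearMap.toMatrix_comp ((euclideanStdBasis a).prod (euclideanStdBasis b))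
    ((euclideanStdBasis a).prod (euclideanStdBasis b)) (euclideanStdBasis n)]
  simp only [Matrix.reindex_apply, Equiv.refl_symm, Equiv.coe_refl]
  rw [← Matrix.submatrix_mul_equiv _ _ _ (finSumFinEquiv.trans (finCongr h)).symm]

/-- `det [u ∘ r | w] = det [u | w] · det r`. [folklore] -/
theorem det_crossingMatrix_comp_left (h : a + b = n) (u : EuclideanSpace ℝ (Fin a) →ₗ[ℝ] EuclideanSpace ℝ (Fin n)) (r : EuclideanSpace ℝ (Fin a) →ₗ[ℝ] EuclideanSpace ℝ (Fin a))
    (w : EuclideanSpace ℝ (Fin b) →ₗ[ℝ] EuclideanSpace ℝ (Fin n)) :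
    (crossingMatrix h (u ∘ₗ r) w).det = (crossingMatrix h u w).det * LinearMap.det r := by
  rw [crossingMatrix_comp_left, Matrix.det_mul, Matrix.det_reindex_self, LinearMap.det_toMatrix,
    LinearMap.det_prodMap, LinearMap.det_id, mul_one]

/-- `det [u | w ∘ r] = det [u | w] · det r`. [folklore] -/
theorem det_crossingMatrix_comp_right (h : a + b = n) (u : EuclideanSpace ℝ (Fin a) →ₗ[ℝ] EuclideanSpace ℝ (Fin n)) (w : EuclideanSpace ℝ (Fin b) →ₗ[ℝ] EuclideanSpace ℝ (Fin n))
    (r : EuclideanSpace ℝ (Fin b) →ₗ[ℝ] EuclideanSpace ℝ (Fin b)) :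
    (crossingMatrix h u (w ∘ₗ r)).det = (crossingMatrix h u w).det * LinearMap.det r := by
  rw [crossingMatrix_comp_right, Matrix.det_mul, Matrix.det_reindex_self, LinearMap.det_toMatrix,
    LinearMap.det_prodMap, LinearMap.det_id, one_mul]

/-- Two distinct orientations of `ℝᵐ` have opposite characters. [folklore] -/
theorem orientationSign_eq_neg_of_ne {m : ℕ} {o o' : Orientation ℝ (EuclideanSpace ℝ (Fin m)) (Fin (finrank ℝ (EuclideanSpace ℝ (Fin m))))}
    (hne : o ≠ o') : orientationSign o = -orientationSign o' := by
  rcases o.eq_or_eq_neg o' (Fintype.card_fin _) with h | h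
  · exact absurd h hne
  · rw [h, orientationSign_neg]

end LinearAlgebra

/-! ### Reparametrising the first map -/

section Reparam

variable {a b n : ℕ}
  {HA : Type*} [TopologicalSpace HA] {IA : ModelWithCorners ℝ (EuclideanSpace ℝ (Fin a)) HA}
  {HA' : Type*} [TopologicalSpace HA'] {IA' : ModelWithCorners ℝ (EuclideanSpace ℝ (Fin a)) HA'}
  {HB : Type*} [TopologicalSpace HB] {IB : ModelWithCorners ℝ (EuclideanSpace ℝ (Fin b)) HB}
  {HX : Type*} [TopologicalSpace HX] {IX : ModelWithCorners ℝ (EuclideanSpace ℝ (Fin n)) HX}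
  {A : Type*} [TopologicalSpace A] [ChartedSpace HA A]
  {A' : Type*} [TopologicalSpace A'] [ChartedSpace HA' A']
  {B : Type*} [TopologicalSpace B] [ChartedSpace HB B]
  {X : Type*} [TopologicalSpace X] [ChartedSpace HX X]

/-- **The chain rule on crossing matrices**: for `ρ : A' → A` differentiable at `x` and `s`
differentiable at `ρ x`, `det [d(s ∘ ρ)_x | dp_y] = det [ds_{ρ x} | dp_y] · det dρ_x`. [folklore] -/
theorem det_crossingMatrixAt_comp_left (h : a + b = n) {s : A → X} {ρ : A' → A} (p : B → X)
    {x : A'} (hs : MDifferentiableAt IA IX s (ρ x)) (hρ : MDifferentiableAt IA' IA ρ x) (y : B) :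
    (crossingMatrixAt IA' IB IX h (s ∘ ρ) p x y).det =
      (crossingMatrixAt IA IB IX h s p (ρ x) y).det *
        LinearMap.det (M := EuclideanSpace ℝ (Fin a)) (mfderiv IA' IA ρ x).toLinearMap := by
  unfold crossingMatrixAt
  rw [mfderiv_comp x hs hρ]
  exact det_crossingMatrix_comp_left h _ _ _

/-- Transversality at a pair of points is invariant under a reparametrisation `ρ` of the first
source with invertible differential. [folklore] -/
theorem mapsTransverseAt_comp_left_iff (h : a + b = n) {s : A → X} {ρ : A' → A} (p : B → X)
    {x : A'} (hs : MDifferentiableAt IA IX s (ρ x)) (hρ : MDifferentiableAt IA' IA ρ x)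
    (hdet : LinearMap.det (M := EuclideanSpace ℝ (Fin a)) (mfderiv IA' IA ρ x).toLinearMap ≠ 0) (y : B) :
    MapsTransverseAt IA' IB IX h (s ∘ ρ) p x y ↔ MapsTransverseAt IA IB IX h s p (ρ x) y := by
  unfold MapsTransverseAt
  rw [det_crossingMatrixAt_comp_left h p hs hρ y]
  exact ⟨fun H H0 => H (by rw [H0, zero_mul]), fun H => mul_ne_zero H hdet⟩

/-- **Transversality is invariant under reparametrisation**: for a surjective `ρ : A' → A`,
differentiable with invertible differential everywhere, and `s` differentiable, `s ∘ ρ` is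
transverse to `p` iff `s` is. [folklore] -/
theorem mapsTransverse_comp_left_iff (h : a + b = n) {s : A → X} {ρ : A' → A} (p : B → X)
    (hs : MDifferentiable IA IX s) (hρ : MDifferentiable IA' IA ρ)
    (hdet : ∀ x, LinearMap.det (M := EuclideanSpace ℝ (Fin a)) (mfderiv IA' IA ρ x).toLinearMap ≠ 0)
    (hsurj : Surjective ρ) :
    MapsTransverse IA' IB IX h (s ∘ ρ) p ↔ MapsTransverse IA IB IX h s p := by
  constructor
  · intro H x y hxy
    obtain ⟨x', rfl⟩ := hsurj x
    exact (mapsTransverseAt_comp_left_iff h p (hs _) (hρ x') (hdet x') y).1 (H x' y hxy)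
  · intro H x' y hxy
    exact (mapsTransverseAt_comp_left_iff h p (hs _) (hρ x') (hdet x') y).2 (H (ρ x') y hxy)

variable [IsManifold IA 1 A] [IsManifold IA' 1 A'] [IsManifold IB 1 B] [IsManifold IX 1 X]

/-- **Local signs under an orientation-preserving reparametrisation** (Milnor 1965, §6,
Remark 2; Hirsch §4.4): if `ρ : A' → A` preserves the orientations `oA'`, `oA`
(`Literature.Topology.FourManifolds.IsOrientationPreserving`) and has invertible differential at `x`, the local
intersection sign of `s ∘ ρ` and `p` at `(x, y)` is that of `s` and `p` at `(ρ x, y)`.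
[cite: MilnorHCobordism1965, §6 Remark 2 (PDF p. 36)] -/
theorem localIntersectionSign_comp_left_of_isOrientationPreserving (h : a + b = n)
    {oA : SmoothOrientation IA A} {oA' : SmoothOrientation IA' A'} (oB : SmoothOrientation IB B)
    (oX : SmoothOrientation IX X) {s : A → X} {ρ : A' → A} (p : B → X)
    (hor : IsOrientationPreserving oA' oA ρ) {x : A'} (hs : MDifferentiableAt IA IX s (ρ x))
    (hρ : MDifferentiableAt IA' IA ρ x)
    (hdet : LinearMap.det (M := EuclideanSpace ℝ (Fin a)) (mfderiv IA' IA ρ x).toLinearMap ≠ 0) (y : B) :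
    localIntersectionSign IA' IB IX h oA' oB oX (s ∘ ρ) p x y =
      localIntersectionSign IA IB IX h oA oB oX s p (ρ x) y := by
  unfold localIntersectionSign
  rw [det_crossingMatrixAt_comp_left h p hs hρ y, sign_mul, SignType.coe_mul, Function.comp_apply]
  have key : (SignType.sign (LinearMap.det (M := EuclideanSpace ℝ (Fin a)) (mfderiv IA' IA ρ x).toLinearMap) : ℤ) *
      orientationSign (oA' x) = orientationSign (oA (ρ x)) := by
    rcases lt_or_gt_of_ne hdet with hlt | hgt
    · have hne : oA (ρ x) ≠ oA' x := fun he => absurd ((hor x).1 he) (not_lt.2 hlt.le)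
      rw [sign_neg hlt, orientationSign_eq_neg_of_ne hne]
      simp
    · rw [sign_pos hgt, (hor x).2 hgt]
      simp
  rw [← key]
  ring

/-- **Local signs under an orientation-reversing reparametrisation** (Milnor 1965, §6,
Remark 2): if `ρ` reverses the orientations, the local sign of `s ∘ ρ` and `p` at `(x, y)` is
minus that of `s` and `p` at `(ρ x, y)`. [cite: MilnorHCobordism1965, §6 Remark 2 (PDF p. 36)] -/
theorem localIntersectionSign_comp_left_of_isOrientationReversing (h : a + b = n)
    {oA : SmoothOrientation IA A} {oA' : SmoothOrientation IA' A'} (oB : SmoothOrientation IB B)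
    (oX : SmoothOrientation IX X) {s : A → X} {ρ : A' → A} (p : B → X)
    (hor : IsOrientationReversing oA' oA ρ) {x : A'} (hs : MDifferentiableAt IA IX s (ρ x))
    (hρ : MDifferentiableAt IA' IA ρ x)
    (hdet : LinearMap.det (M := EuclideanSpace ℝ (Fin a)) (mfderiv IA' IA ρ x).toLinearMap ≠ 0) (y : B) :
    localIntersectionSign IA' IB IX h oA' oB oX (s ∘ ρ) p x y =
      -localIntersectionSign IA IB IX h oA oB oX s p (ρ x) y := by
  rw [isOrientationReversing_iff] at hor
  rw [localIntersectionSign_comp_left_of_isOrientationPreserving h oB oX p hor hs hρ hdet y,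
    localIntersectionSign_neg_left]

omit [TopologicalSpace A] [TopologicalSpace A'] [TopologicalSpace B] [TopologicalSpace X]
  [ChartedSpace HA A] [ChartedSpace HA' A'] [ChartedSpace HB B] [ChartedSpace HX X]
  [IsManifold IA 1 A] [IsManifold IA' 1 A'] [IsManifold IB 1 B] [IsManifold IX 1 X] in
/-- The double points of `s ∘ ρ` and `p` correspond to those of `s` and `p` under
`(x, y) ↦ (ρ x, y)`, bijectively if `ρ` is bijective. [folklore] -/
theorem bijOn_doublePoints_comp_left {s : A → X} {ρ : A' → A} (p : B → X) (hρ : Bijective ρ) :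
    BijOn (fun q : A' × B => (ρ q.1, q.2)) (doublePoints (s ∘ ρ) p) (doublePoints s p) := by
  refine ⟨fun q hq => hq, fun q _ q' _ hqq' => ?_, fun q hq => ?_⟩
  · simp only [Prod.mk.injEq] at hqq'
    exact Prod.ext (hρ.1 hqq'.1) hqq'.2
  · obtain ⟨x', hx'⟩ := hρ.2 q.1
    refine ⟨(x', q.2), ?_, by simp [hx']⟩
    change s (ρ x') = p q.2
    rw [hx']
    exact hq

/-- **Intersection numbers under an orientation-preserving reparametrisation** (Milnor 1965,
§6, Remark 2): for a bijective `ρ : A' → A`, differentiable with invertible differential and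
preserving the orientations, and `s` differentiable, `(s ∘ ρ) · p = s · p`.
[cite: MilnorHCobordism1965, §6 Remark 2 (PDF p. 36)] -/
theorem intersectionNumber_comp_left_of_isOrientationPreserving (h : a + b = n)
    {oA : SmoothOrientation IA A} {oA' : SmoothOrientation IA' A'} (oB : SmoothOrientation IB B)
    (oX : SmoothOrientation IX X) {s : A → X} {ρ : A' → A} (p : B → X)
    (hor : IsOrientationPreserving oA' oA ρ) (hs : MDifferentiable IA IX s)
    (hρ : MDifferentiable IA' IA ρ)
    (hdet : ∀ x, LinearMap.det (M := EuclideanSpace ℝ (Fin a)) (mfderiv IA' IA ρ x).toLinearMap ≠ 0)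
    (hbij : Bijective ρ) :
    intersectionNumber IA' IB IX h oA' oB oX (s ∘ ρ) p =
      intersectionNumber IA IB IX h oA oB oX s p := by
  unfold intersectionNumber
  refine finsum_mem_eq_of_bijOn (fun q : A' × B => (ρ q.1, q.2))
    (bijOn_doublePoints_comp_left p hbij) fun q _ => ?_
  exact localIntersectionSign_comp_left_of_isOrientationPreserving h oB oX p hor (hs _) (hρ _)
    (hdet _) q.2

/-- **Intersection numbers under an orientation-reversing reparametrisation** (Milnor 1965,
§6, Remark 2): with `ρ` as above but reversing the orientations, `(s ∘ ρ) · p = -(s · p)`.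
[cite: MilnorHCobordism1965, §6 Remark 2 (PDF p. 36)] -/
theorem intersectionNumber_comp_left_of_isOrientationReversing (h : a + b = n)
    {oA : SmoothOrientation IA A} {oA' : SmoothOrientation IA' A'} (oB : SmoothOrientation IB B)
    (oX : SmoothOrientation IX X) {s : A → X} {ρ : A' → A} (p : B → X)
    (hor : IsOrientationReversing oA' oA ρ) (hs : MDifferentiable IA IX s)
    (hρ : MDifferentiable IA' IA ρ)
    (hdet : ∀ x, LinearMap.det (M := EuclideanSpace ℝ (Fin a)) (mfderiv IA' IA ρ x).toLinearMap ≠ 0)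
    (hbij : Bijective ρ) :
    intersectionNumber IA' IB IX h oA' oB oX (s ∘ ρ) p =
      -intersectionNumber IA IB IX h oA oB oX s p := by
  rw [isOrientationReversing_iff] at hor
  rw [intersectionNumber_comp_left_of_isOrientationPreserving h oB oX p hor hs hρ hdet hbij,
    intersectionNumber_neg_left]

end Reparam

/-! ### Diffeomorphisms -/

section Diffeomorph

variable {a b n : ℕ}
  {HA : Type*} [TopologicalSpace HA] {IA : ModelWithCorners ℝ (EuclideanSpace ℝ (Fin a)) HA}
  {HA' : Type*} [TopologicalSpace HA'] {IA' : ModelWithCorners ℝ (EuclideanSpace ℝ (Fin a)) HA'}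
  {HB : Type*} [TopologicalSpace HB] {IB : ModelWithCorners ℝ (EuclideanSpace ℝ (Fin b)) HB}
  {HX : Type*} [TopologicalSpace HX] {IX : ModelWithCorners ℝ (EuclideanSpace ℝ (Fin n)) HX}
  {A : Type*} [TopologicalSpace A] [ChartedSpace HA A]
  {A' : Type*} [TopologicalSpace A'] [ChartedSpace HA' A']
  {B : Type*} [TopologicalSpace B] [ChartedSpace HB B]
  {X : Type*} [TopologicalSpace X] [ChartedSpace HX X]

/-- The differential of a diffeomorphism has non-zero determinant (it is invertible,
`Diffeomorph.mfderivToContinuousLinearEquiv`). [folklore] -/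
theorem Diffeomorph.det_mfderiv_ne_zero (ρ : A' ≃ₘ⟮IA', IA⟯ A) (x : A') :
    LinearMap.det (M := EuclideanSpace ℝ (Fin a)) (mfderiv IA' IA ρ x).toLinearMap ≠ 0 := by
  exact ((ρ.mfderivToContinuousLinearEquiv (by simp) x).toLinearEquiv.isUnit_det').ne_zero

/-- **Transversality under a diffeomorphism of the first source**: `s ∘ ρ` is transverse to
`p` iff `s` is. [folklore] -/
theorem mapsTransverse_comp_diffeomorph_iff (h : a + b = n) {s : A → X} (ρ : A' ≃ₘ⟮IA', IA⟯ A)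
    (p : B → X) (hs : MDifferentiable IA IX s) :
    MapsTransverse IA' IB IX h (s ∘ ρ) p ↔ MapsTransverse IA IB IX h s p :=
  mapsTransverse_comp_left_iff h p hs (ρ.mdifferentiable (by simp))
    (Diffeomorph.det_mfderiv_ne_zero ρ) ρ.surjective

variable [IsManifold IA 1 A] [IsManifold IA' 1 A'] [IsManifold IB 1 B] [IsManifold IX 1 X]

/-- **Intersection numbers under an orientation-preserving diffeomorphism of the first source**
(Milnor 1965, §6, Remark 2): `(s ∘ ρ) · p = s · p`. [cite: MilnorHCobordism1965, §6 Remark 2 (PDF p. 36)] -/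
theorem intersectionNumber_comp_diffeomorph_of_isOrientationPreserving (h : a + b = n)
    {oA : SmoothOrientation IA A} {oA' : SmoothOrientation IA' A'} (oB : SmoothOrientation IB B)
    (oX : SmoothOrientation IX X) {s : A → X} (ρ : A' ≃ₘ⟮IA', IA⟯ A) (p : B → X)
    (hor : ρ.IsOrientationPreserving oA' oA) (hs : MDifferentiable IA IX s) :
    intersectionNumber IA' IB IX h oA' oB oX (s ∘ ρ) p =
      intersectionNumber IA IB IX h oA oB oX s p :=
  intersectionNumber_comp_left_of_isOrientationPreserving h oB oX p hor hs
    (ρ.mdifferentiable (by simp)) (Diffeomorph.det_mfderiv_ne_zero ρ) ρ.bijective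

/-- **Intersection numbers under an orientation-reversing diffeomorphism of the first source**
(Milnor 1965, §6, Remark 2): `(s ∘ ρ) · p = -(s · p)`. [cite: MilnorHCobordism1965, §6 Remark 2 (PDF p. 36)] -/
theorem intersectionNumber_comp_diffeomorph_of_isOrientationReversing (h : a + b = n)
    {oA : SmoothOrientation IA A} {oA' : SmoothOrientation IA' A'} (oB : SmoothOrientation IB B)
    (oX : SmoothOrientation IX X) {s : A → X} (ρ : A' ≃ₘ⟮IA', IA⟯ A) (p : B → X)
    (hor : ρ.IsOrientationReversing oA' oA) (hs : MDifferentiable IA IX s) :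
    intersectionNumber IA' IB IX h oA' oB oX (s ∘ ρ) p =
      -intersectionNumber IA IB IX h oA oB oX s p :=
  intersectionNumber_comp_left_of_isOrientationReversing h oB oX p hor hs
    (ρ.mdifferentiable (by simp)) (Diffeomorph.det_mfderiv_ne_zero ρ) ρ.bijective

end Diffeomorph

end Literature.Topology.FourManifolds

end
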